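import Summits.KontsevichZagierPeriods.KontsevichZagierPeriods.Theses.SymplecticScissors
import Literature.NumberTheory.Transcendental.KZCalculus

/-!
# `RealOnePeriodRelations` (stmt-KontsevichZagierPeriods-10042) — negative side 0: kit

Crux (route `SymplecticScissors`): `∀ c ∈ H₁, eval c = 0 → c ∈ M₁`, `H₁ = closure (range of₁)`,
`M₁ = closure (1a ∪ 1b ∪ 2 ∪ Green)` with the typed Green generator on the standard triangle `Δ`
(`greenSet`, verbatim; `crux_iff` is `Iff.rfl`). This file fixes that vocabulary and the small kit
used by `Negative/GreenSound`, `Negative/LoadBearing`, `Negative/Tightness`: the unit-interval domain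
`unitDom ⊂ ℝ¹` with `setIntegral_unitDom` (set integrals over it are interval integrals over `(0,1)`)
and `volume_unitDom = 1`, and the constant representations `constRep₁ q = [∫_{(0,1)} q]` (dimension 1)
and `constRep₀ q = [q]₀` (dimension 0, the base of the calculus), with their values.
[Kontsevich–Zagier 2001, §1.1–1.2]
-/

noncomputable section

open scoped BigOperators Topology
open Set MeasureTheory Filter
open Literature.NumberTheory.Transcendental

namespace Summit.KontsevichZagierPeriods.SymplecticScissors.RealOnePeriodRelationsNegative

/-! ## §0 Vocabulary (verbatim from the crux) -/

/-- The closed standard triangle `Δ = {0 ≤ a, 0 ≤ b, a + b ≤ 1}`. [folklore] -/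
def Δ : Set (Fin 2 → ℝ) := {p | 0 ≤ p 0 ∧ 0 ≤ p 1 ∧ p 0 + p 1 ≤ 1}

/-- The GREEN GENERATOR family of the crux, verbatim. [cite: KontsevichZagier2001, §1.2] -/
def greenSet : Set KZ.FormalRep :=
  {g : KZ.FormalRep | ∃ (Δ : Set (Fin 2 → ℝ)) (A B S : (Fin 2 → ℝ) → ℝ) (r₀₁ r₁₂ r₀₂ : KZ.IntegralRep 1),
    Δ = {p | 0 ≤ p 0 ∧ 0 ≤ p 1 ∧ p 0 + p 1 ≤ 1} ∧ IsSemialgebraicFunOn ℚ Δ A ∧ IsSemialgebraicFunOn ℚ Δ B ∧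
    ContinuousOn A Δ ∧ ContinuousOn B Δ ∧
    (∀ p : Fin 2 → ℝ, 0 < p 0 → 0 < p 1 → p 0 + p 1 < 1 →
      HasFDerivAt S (A p • ContinuousLinearMap.proj (R := ℝ) (φ := fun _ : Fin 2 => ℝ) 0 +
        B p • ContinuousLinearMap.proj (R := ℝ) (φ := fun _ : Fin 2 => ℝ) 1) p) ∧
    r₀₁.domain = {z | z 0 ∈ Set.Ioo 0 1} ∧ r₁₂.domain = {z | z 0 ∈ Set.Ioo 0 1} ∧
    r₀₂.domain = {z | z 0 ∈ Set.Ioo 0 1} ∧ (∀ z ∈ r₀₁.domain, r₀₁.integrand z = A ![z 0, 0]) ∧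
    (∀ z ∈ r₁₂.domain, r₁₂.integrand z = B ![1 - z 0, z 0] - A ![1 - z 0, z 0]) ∧
    (∀ z ∈ r₀₂.domain, r₀₂.integrand z = B ![0, z 0]) ∧ g = KZ.of r₀₁ + KZ.of r₁₂ - KZ.of r₀₂}

/-- `M₁`: the conclusion subgroup (rules 1a, 1b, 2 and the Green generator). [cite: KontsevichZagier2001, §1.2] -/
def M₁ : AddSubgroup KZ.FormalRep :=
  AddSubgroup.closure (KZ.domainAddRel ∪ KZ.integrandAddRel ∪ KZ.changeOfVariablesRel ∪ greenSet)

/-- `H₁`: the subgroup generated by the 1-dimensional representations. [cite: KontsevichZagier2001, §1.2] -/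
def H₁ : AddSubgroup KZ.FormalRep :=
  AddSubgroup.closure (Set.range fun r : KZ.IntegralRep 1 => KZ.of r)

/-! ## §1 The crux, unfolded -/

/-- The crux IS `∀ c ∈ H₁, eval c = 0 → c ∈ M₁` (definitional). [cite: HuberWustholz2022, Thm 13.3 (2)] -/
theorem crux_iff :
    Summit.KontsevichZagierPeriods.KontsevichZagierPeriods.Theses.SymplecticScissors.RealOnePeriodRelations ↔
      ∀ c : KZ.FormalRep, c ∈ H₁ → KZ.eval c = 0 → c ∈ M₁ :=
  Iff.rfl

/-! ## §2 Soundness of the Green generator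

### §2.1 The unit interval as a domain in `ℝ¹` -/

/-- The unit interval domain `{z : ℝ¹ | z 0 ∈ (0,1)}` of the three edge representations. [folklore] -/
def unitDom : Set (Fin 1 → ℝ) := {z | z 0 ∈ Set.Ioo 0 1}

/-- `unitDom` is measurable. [folklore] -/
theorem measurableSet_unitDom : MeasurableSet unitDom :=
  measurableSet_Ioo.preimage (measurable_pi_apply 0)

/-- `unitDom` is the preimage of `(0,1)` under the canonical identification `ℝ¹ ≃ ℝ`. [folklore] -/
theorem funUnique_preimage_Ioo :
    (MeasurableEquiv.funUnique (Fin 1) ℝ) ⁻¹' Set.Ioo 0 1 = unitDom := by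
  ext z
  simp [unitDom, MeasurableEquiv.funUnique_apply, Fin.default_eq_zero]

/-- Set integrals over `unitDom ⊂ ℝ¹` are interval integrals over `(0,1)`. [folklore] -/
theorem setIntegral_unitDom (g : ℝ → ℝ) :
    ∫ z in unitDom, g (z 0) = ∫ t in (0:ℝ)..1, g t := by
  have hmp : MeasurePreserving (MeasurableEquiv.funUnique (Fin 1) ℝ) volume volume :=
    volume_preserving_funUnique (Fin 1) ℝ
  have h := hmp.setIntegral_preimage_emb (MeasurableEquiv.measurableEmbedding _) g (Set.Ioo 0 1)
  rw [funUnique_preimage_Ioo] at h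
  simp only [MeasurableEquiv.funUnique_apply, Fin.default_eq_zero] at h
  rw [h, intervalIntegral.integral_of_le zero_le_one, integral_Ioc_eq_integral_Ioo]

/-- The volume of `unitDom` is `1`. [folklore] -/
theorem volume_unitDom : volume unitDom = 1 := by
  have hmp : MeasurePreserving (MeasurableEquiv.funUnique (Fin 1) ℝ) volume volume :=
    volume_preserving_funUnique (Fin 1) ℝ
  rw [← funUnique_preimage_Ioo, hmp.measure_preimage measurableSet_Ioo.nullMeasurableSet]
  simp


/-! ## §3 Kit: constant representations on the unit interval and on the point -/

/-- `unitDom` is `ℚ`-semialgebraic (`0 < z₀` and `0 < 1 − z₀`). [folklore] -/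
theorem isSemialgebraic_unitDom : Literature.ModelTheory.ExponentialFields.IsSemialgebraic ℚ unitDom := by
  have h1 := Literature.ModelTheory.ExponentialFields.isSemialgebraic_setOf_eval_pos (k := ℚ)
    (R := ℝ) (MvPolynomial.X (0 : Fin 1) : MvPolynomial (Fin 1) ℚ)
  have h2 := Literature.ModelTheory.ExponentialFields.isSemialgebraic_setOf_eval_pos (k := ℚ)
    (R := ℝ) (1 - MvPolynomial.X (0 : Fin 1) : MvPolynomial (Fin 1) ℚ)
  convert h1.inter h2 using 1
  ext z
  simp [unitDom, sub_pos]

/-- Rational constants are `ℚ`-semialgebraic functions on any `ℚ`-semialgebraic set. [folklore] -/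
theorem isSemialgebraicFunOn_ratConst {m : ℕ} {s : Set (Fin m → ℝ)}
    (hs : Literature.ModelTheory.ExponentialFields.IsSemialgebraic ℚ s) (q : ℚ) :
    IsSemialgebraicFunOn ℚ s (fun _ => (q : ℝ)) := by
  have h := isSemialgebraicFunOn_aeval hs (MvPolynomial.C q : MvPolynomial (Fin m) ℚ)
  refine h.congr fun x _ => ?_
  simp

/-- The representation `∫_{(0,1)} q dt` of a rational constant `q` (dimension 1). [folklore] -/
def constRep₁ (q : ℚ) : KZ.IntegralRep 1 where
  domain := unitDom
  integrand := fun _ => (q : ℝ)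
  isSemialgebraic_domain := isSemialgebraic_unitDom
  isSemialgebraicFunOn_integrand := isSemialgebraicFunOn_ratConst isSemialgebraic_unitDom q
  integrableOn := integrableOn_const (by simp [volume_unitDom])

/-- Domain of `constRep₁`. [folklore] -/
@[simp] theorem constRep₁_domain (q : ℚ) : (constRep₁ q).domain = unitDom := rfl

/-- Integrand of `constRep₁`. [folklore] -/
@[simp] theorem constRep₁_integrand (q : ℚ) : (constRep₁ q).integrand = fun _ => (q : ℝ) := rfl

/-- `value [∫_{(0,1)} q] = q`. [folklore] -/
@[simp] theorem value_constRep₁ (q : ℚ) : (constRep₁ q).value = q := by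
  simp [KZ.IntegralRep.value, Measure.real, volume_unitDom]

/-- The representation of the rational constant `q` in dimension `0` (the point `ℝ⁰`, volume `1`;
"the intended base of the calculus", `KZCalculus` design notes). [cite: KontsevichZagier2001, §1.1] -/
def constRep₀ (q : ℚ) : KZ.IntegralRep 0 where
  domain := Set.univ
  integrand := fun _ => (q : ℝ)
  isSemialgebraic_domain := Literature.ModelTheory.ExponentialFields.isSemialgebraic_univ
  isSemialgebraicFunOn_integrand :=
    isSemialgebraicFunOn_ratConst Literature.ModelTheory.ExponentialFields.isSemialgebraic_univ q
  integrableOn := integrableOn_const (by simp [volume_pi])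

/-- `value [q]₀ = q`. [folklore] -/
@[simp] theorem value_constRep₀ (q : ℚ) : (constRep₀ q).value = q := by
  simp [KZ.IntegralRep.value, constRep₀, Measure.real, volume_pi]

end Summit.KontsevichZagierPeriods.SymplecticScissors.RealOnePeriodRelationsNegative

end
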